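import Mathlib.Analysis.SpecialFunctions.Gaussian.GaussianIntegral
import Mathlib.Analysis.SumIntegralComparisons
import Mathlib.Analysis.Normed.Ring.InfiniteSum
import Mathlib.Topology.Algebra.InfiniteSum.Real
import Mathlib.Topology.Algebra.InfiniteSum.NatInt
import Mathlib.Data.Int.Interval
import Literature.MathematicalPhysics.QuantumFieldTheory.DimockYuan2024.OneLoopCoefficient
import HarnessLib

/-!
# Dimock–Yuan, Lemma 11: the `k`-uniform two-sided bounds of the primed momentum sums over the dual tori

**Citation header (reproduction of PUBLISHED work; β sub-cell literature seat LIT2 of the Balaban lattice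
Yang–Mills cell `pub-balaban`, row file `HOME/BETA/LIT2.md` §1.4, `HOME/BETA/TRANSFER.md` §15).**
J. Dimock, C. Yuan, *Structural stability of the RG flow in the Gross–Neveu model*,
Ann. Henri Poincaré **25** (2024) 5113–5186 (= arXiv:2303.07916v3) [DimockYuan2024GrossNeveuFlow],
§3.6 "Estimates", **Lemma 11 (1)** (TeX label `eleven`, arXiv source ll. 2229–2237):
"There exist positive constants `C_±` such that `(n−1)C₋ ≤ β_k ≤ (n−1)C₊`", where (ll. 2224–2225)
"The letter `C` stands for a constant that may depend on `L`" (NOT on `k`, `N`, `M`), with its proof ll. 2241–2278.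

**What is reproduced (everything PROVED, no named facts, no `sorry`).**  The sibling module
`DimockYuan2024.OneLoopCoefficient` proves the printed argument MODE BY MODE and lists as NOT reproduced exactly one
step (its header; LIT2.md §1.4): "the `k`-uniform two-sided bounds of the two Riemann sums over the dual tori
`𝕋*_{M+N−k}` (the printed 'which suffices', ll. 2260/2268)".  This file proves that step, with EXPLICIT constants,
and assembles Lemma 11 (1) for the printed momentum-sum expression of `β_k`:
* the objects (ll. 316, 357–364, 378–384, 1244–1246): the dual torus `𝕋*_j = 2πL^{−j}ℤ²` (`j = M+N−k ≥ 0`), the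
  primed sum `Σ'_{p∈𝕋*_j}[⋯] = L^{−2j} Σ_{p∈𝕋*_j, p≠0}[⋯]` (`primedSum`), the two printed integrals in momentum form
  "`∫C_k² = Σ'_p (1/p²)(e^{−p²} − e^{−L²p²})²`" (l. 2249, `intCsq`) and
  "`∫2w_kC_k = 2Σ'_p (1/p²)(e^{−p²/L^{2k}} − e^{−p²})(e^{−p²} − e^{−L²p²})`" (l. 2273, `intCross`), and
  "`β_k = 4(n−1)∫[2w_kC_k + C_k²]`" (l. 2244, `betaStep`);
* §1: the one-dimensional Gaussian lattice sum `Σ_{i∈ℤ} e^{−h²i²} ≤ 1 + √π/h` for EVERY mesh `h > 0` (integral test,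
  Mathlib `AntitoneOn.tsum_le_integral` + `integral_gaussian_Ioi`), hence `Σ_{n∈ℤ²} e^{−h²|n|²} ≤ (1 + √π/h)²` and,
  with the primed weight `L^{−2j} = (h/2π)²`, `h = 2πL^{−j} ≤ 2π`: `Σ'_p e^{−p²} ≤ (1 + √π/(2π))²` UNIFORMLY IN `j ≥ 0`
  (`primedSum_exp_le`) — the upper half of 'which suffices';
* §3: the lower half BY ONE SQUARE ANNULUS AT SCALE `1/h`: with `m = ⌈1/h⌉` the `(m+1)(2m+1) ≥ 2m²` lattice points
  `n ∈ [m,2m] × [−m,m]` have `p² = h²|n|² ∈ [1, 5(1+2π)²]`, so `Σ'_p F(p²) ≥ F₀/(2π²)` whenever `F ≥ F₀` on that window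
  (`primedSum_lower`) — uniform in `j ≥ 0` INCLUDING the unit torus `j = 0`, where the printed small-momentum region
  `(L²−1)p² ≤ 1` is empty and the lower bound comes from the large region alone (LIT2.md §1.4: "this is why the proof
  needs BOTH regions' lower bounds and says 'which also suffices'");
* §4: the printed two-region display (`intCsq_regions`), the region sums bounded above uniformly in `j`
  (`regionSmall_le`, `regionLarge_le`) and the large-region sum bounded BELOW uniformly in `j` (`regionLarge_lower`),
  the cross term "positive" and "bounded by a constant" (`intCross_nonneg`, `intCross_le`);
* §5: **Lemma 11 (1)** for the explicit expression: for every real `L ≥ 2`, every `j k : ℕ` and every `n ≥ 1`,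
  `(n−1)·C₋ ≤ β_k ≤ (n−1)·C₊(L)` with `C₋ = 2(1−e^{−1})² e^{−2T}/(π²T)`, `T = 5(1+2π)²` (free of `L`, `j`, `k`) and
  `C₊(L) = 16(L²−1)(1 + √π/(2π))²` (free of `j`, `k`) (`DimockYuan2024_lemma11_part1`, `Cminus_pos`).

**Recorded print-level remark (immaterial).**  The printed lower display of the small region reads
"`e^{−1}(L²−1)² Σ'_{(L²−1)p²≤1} p²e^{−2p²} ≤ ∫C_k²`" (l. 2258); squaring the quoted inequality "`xe^{−1} ≤ 1 − e^{−x}`"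
gives the constant `e^{−2}`, which is what `OneLoopCoefficient.sliceMult_sq_bounds_small` and `intCsq_regions` below carry.
(The display with `e^{−1}` is also true — it needs the sharper `e^{−1/2}x ≤ 1 − e^{−x}` on `[0,1]`, by concavity — but it is
not what the displayed argument yields; Lemma 11 needs only SOME positive constant.)  The cross term's index set is printed
`𝕋*_{N+M}` (l. 2273) for `𝕋*_{M+N−k}` (by (wk)/(gk)); immaterial.

**What is NOT reproduced.**  Step (b) of the printed proof — that D–Y's `∫C_k²`, `∫2w_kC_k` (Grassmann/Dirac objects on
the continuum torus `ℝ²/L^jℤ²`) EQUAL these momentum sums (Plancherel + `(−ip̸)² = −p²`; ll. 2249, 2273, eq. (kingly)) — is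
model structure, not estimated here: the file starts from the printed momentum-sum expressions.  Part (2) of Lemma 11
(`θ_k` bounded, via App. D position-space bounds) is not touched.

**Why it is in the tree / honest framing.**  Kernel form of the one untyped step of lemma shape DY-11 (LIT2.md §1.5):
WHAT a `k`-uniform two-sided bound of a marginal one-loop coefficient consumes from the momentum sums of a multiscale
scheme on tori of ALL sizes `L^j ≥ 1` — an integral test for the bulk and one square annulus at scale `1/h` for
positivity, with constants free of the torus.  SIBLING-MODEL technology (GN₂, continuum torus, same-sign multipliers);
NOTHING here refers to or asserts anything about Bałaban's β-functions (CMP 109 (1.22)), whose one-loop coefficient is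
a SIGNED vacuum-polarisation sum (LIT2.md §7); not summit progress.
-/

noncomputable section

open Real Set MeasureTheory Finset

namespace Literature.MathematicalPhysics.QuantumFieldTheory.DimockYuan2024

namespace DualTorus

/-! ## §1 One-dimensional Gaussian lattice sums, uniformly in the mesh `h` -/

/-- The one-dimensional Gaussian weight `e^{−h²x²}` of mesh `h` (as a function of a real variable; on the lattice
`hℤ` it is the weight `e^{−p²}`, `p = hx`). [folklore] -/
def gaussR (h x : ℝ) : ℝ := Real.exp (-h ^ 2 * x ^ 2)

/-- `e^{−h²x²} > 0`. [folklore] -/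
theorem gaussR_pos (h x : ℝ) : 0 < gaussR h x := Real.exp_pos _

/-- `e^{−h²x²} ≥ 0`. [folklore] -/
theorem gaussR_nonneg (h x : ℝ) : 0 ≤ gaussR h x := (Real.exp_pos _).le

/-- `e^{−h²·0²} = 1`. [folklore] -/
theorem gaussR_zero (h : ℝ) : gaussR h 0 = 1 := by simp [gaussR]

/-- evenness `e^{−h²(−x)²} = e^{−h²x²}`. [folklore] -/
theorem gaussR_neg (h x : ℝ) : gaussR h (-x) = gaussR h x := by simp [gaussR]

/-- `e^{−h²x²} ≤ 1`. [folklore] -/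
theorem gaussR_le_one (h x : ℝ) : gaussR h x ≤ 1 := by
  unfold gaussR
  rw [Real.exp_le_one_iff, neg_mul]
  exact neg_nonpos.mpr (mul_nonneg (sq_nonneg h) (sq_nonneg x))

/-- `x ↦ e^{−h²x²}` is antitone on `[0, ∞)`. [folklore] -/
theorem antitoneOn_gaussR (h : ℝ) : AntitoneOn (gaussR h) (Ici 0) := by
  intro x hx y _ hxy
  unfold gaussR
  apply Real.exp_le_exp.mpr
  have hx0 : 0 ≤ x := hx
  have hxy2 : x ^ 2 ≤ y ^ 2 := by nlinarith
  have := mul_le_mul_of_nonneg_left hxy2 (sq_nonneg h)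
  rw [neg_mul, neg_mul]
  exact neg_le_neg this

/-- `x ↦ e^{−h²x²}` is integrable on `(0, ∞)` for `h > 0` (Mathlib `integrable_exp_neg_mul_sq`). [folklore] -/
theorem integrableOn_gaussR {h : ℝ} (hh : 0 < h) : IntegrableOn (gaussR h) (Ioi 0) :=
  (integrable_exp_neg_mul_sq (pow_pos hh 2)).integrableOn

/-- the half-line Gaussian integral `∫₀^∞ e^{−h²x²} dx = √π/(2h)` (Mathlib `integral_gaussian_Ioi`). [folklore] -/
theorem integral_gaussR_Ioi {h : ℝ} (hh : 0 < h) : ∫ x in Ioi (0:ℝ), gaussR h x = √π / (2 * h) := by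
  unfold gaussR
  rw [integral_gaussian_Ioi (h ^ 2), Real.sqrt_div Real.pi_pos.le, Real.sqrt_sq hh.le]
  ring

/-- integral test: `Σ_{i∈ℕ} e^{−h²i²}` converges for every mesh `h > 0`. [folklore] -/
theorem summable_gaussR_nat {h : ℝ} (hh : 0 < h) : Summable fun i : ℕ => gaussR h i :=
  (antitoneOn_gaussR h).summable_of_integrableOn_Ioi_zero (integrableOn_gaussR hh)
    (fun t _ => gaussR_nonneg h t)

/-- integral test: `Σ_{i≥0} e^{−h²i²} ≤ 1 + √π/(2h)` for every mesh `h > 0`. [folklore] -/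
theorem tsum_gaussR_nat_le {h : ℝ} (hh : 0 < h) : ∑' i : ℕ, gaussR h i ≤ 1 + √π / (2 * h) := by
  have := (antitoneOn_gaussR h).tsum_le_integral (integrableOn_gaussR hh) (fun t _ => gaussR_nonneg h t)
  rwa [gaussR_zero, integral_gaussR_Ioi hh] at this

/-- shifted family `Σ_{i≥0} e^{−h²(i+1)²}` converges. [folklore] -/
theorem summable_gaussR_nat_succ {h : ℝ} (hh : 0 < h) : Summable fun i : ℕ => gaussR h ((i : ℝ) + 1) := by
  have := (summable_nat_add_iff (f := fun i : ℕ => gaussR h i) 1).mpr (summable_gaussR_nat hh)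
  simpa [Nat.cast_add, Nat.cast_one] using this

/-- integral test, shifted: `Σ_{i≥1} e^{−h²i²} ≤ √π/(2h)` for every mesh `h > 0`. [folklore] -/
theorem tsum_gaussR_nat_succ_le {h : ℝ} (hh : 0 < h) : ∑' i : ℕ, gaussR h ((i : ℝ) + 1) ≤ √π / (2 * h) := by
  have := (antitoneOn_gaussR h).tsum_add_one_le_integral (integrableOn_gaussR hh)
    (fun t _ => gaussR_nonneg h t)
  rw [integral_gaussR_Ioi hh] at this
  simpa [Nat.cast_add, Nat.cast_one] using this

/-- `Σ_{i∈ℤ} e^{−h²i²}` converges for every mesh `h > 0`. [folklore] -/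
theorem summable_gaussR_int {h : ℝ} (hh : 0 < h) : Summable fun i : ℤ => gaussR h i := by
  refine Summable.of_nat_of_neg_add_one ?_ ?_
  · exact (summable_gaussR_nat hh).congr fun i => by simp
  · refine (summable_gaussR_nat_succ hh).congr fun i => ?_
    push_cast
    rw [gaussR_neg]

/-- **the one-dimensional Gaussian lattice sum, uniformly in the mesh**: `Σ_{i∈ℤ} e^{−h²i²} ≤ 1 + √π/h` for every
`h > 0` (so `h·Σ ≤ h + √π`: a Riemann sum of `e^{−x²}` plus the `i = 0` term). [folklore] -/
theorem tsum_gaussR_int_le {h : ℝ} (hh : 0 < h) : ∑' i : ℤ, gaussR h i ≤ 1 + √π / h := by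
  have h1 : Summable fun i : ℕ => gaussR h ((i : ℤ) : ℝ) :=
    (summable_gaussR_nat hh).congr fun i => by simp
  have h2 : Summable fun i : ℕ => gaussR h ((-((i : ℤ) + 1) : ℤ) : ℝ) := by
    refine (summable_gaussR_nat_succ hh).congr fun i => ?_
    push_cast
    rw [gaussR_neg]
  have e := tsum_of_nat_of_neg_add_one (f := fun i : ℤ => gaussR h i) h1 h2
  have e1 : ∑' i : ℕ, gaussR h ((i : ℤ) : ℝ) = ∑' i : ℕ, gaussR h i := tsum_congr fun i => by simp
  have e2 : ∑' i : ℕ, gaussR h ((-((i : ℤ) + 1) : ℤ) : ℝ) = ∑' i : ℕ, gaussR h ((i : ℝ) + 1) :=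
    tsum_congr fun i => by push_cast; rw [gaussR_neg]
  rw [e, e1, e2]
  have := tsum_gaussR_nat_le hh
  have := tsum_gaussR_nat_succ_le hh
  have hsplit : 1 + √π / (2 * h) + √π / (2 * h) = 1 + √π / h := by
    field_simp
    ring
  linarith

/-! ## §2 The two-dimensional lattice: `p = hn`, `n ∈ ℤ²`, `p² = h²|n|²` -/

/-- squared length `p² = h²(n₁² + n₂²)` of the dual-torus momentum `p = hn`, `n ∈ ℤ²`
("`𝕋*_M = 2πL^{−M}ℤ²`", arXiv TeX l. 316). [cite: DimockYuan2024GrossNeveuFlow, §2.1 (arXiv TeX l. 316)] -/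
def latt (h : ℝ) (n : ℤ × ℤ) : ℝ := h ^ 2 * ((n.1 : ℝ) ^ 2 + (n.2 : ℝ) ^ 2)

/-- `p² ≥ 0`. [folklore] -/
theorem latt_nonneg (h : ℝ) (n : ℤ × ℤ) : 0 ≤ latt h n := by
  unfold latt; positivity

/-- `p² > 0` for `p ≠ 0` (`n ≠ 0`, `h > 0`). [folklore] -/
theorem latt_pos {h : ℝ} (hh : 0 < h) {n : ℤ × ℤ} (hn : n ≠ 0) : 0 < latt h n := by
  unfold latt
  have hsq : 0 < (n.1 : ℝ) ^ 2 + (n.2 : ℝ) ^ 2 := by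
    rcases n with ⟨a, b⟩
    have hab : a ≠ 0 ∨ b ≠ 0 := by
      by_contra hcon
      push Not at hcon
      exact hn (by simp [hcon.1, hcon.2])
    rcases hab with ha | hb
    · have : (0:ℝ) < (a : ℝ) ^ 2 := by positivity
      simp only
      positivity
    · have : (0:ℝ) < (b : ℝ) ^ 2 := by positivity
      simp only
      positivity
  positivity

/-- `e^{−p²} = e^{−h²n₁²}·e^{−h²n₂²}`. [folklore] -/
theorem exp_neg_latt (h : ℝ) (n : ℤ × ℤ) : Real.exp (-(latt h n)) = gaussR h n.1 * gaussR h n.2 := by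
  unfold latt gaussR
  rw [← Real.exp_add]
  congr 1
  ring

/-- `Σ_{n∈ℤ²} e^{−h²|n|²}` converges for every mesh `h > 0` (product of two one-dimensional sums). [folklore] -/
theorem summable_exp_neg_latt {h : ℝ} (hh : 0 < h) : Summable fun n : ℤ × ℤ => Real.exp (-(latt h n)) := by
  have := (summable_gaussR_int hh).mul_of_nonneg (summable_gaussR_int hh) (fun i => gaussR_nonneg h i)
    (fun i => gaussR_nonneg h i)
  exact this.congr fun n => (exp_neg_latt h n).symm

/-- **the two-dimensional Gaussian lattice sum, uniformly in the mesh**: `Σ_{n∈ℤ²} e^{−h²|n|²} ≤ (1 + √π/h)²` for every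
`h > 0`. [folklore] -/
theorem tsum_exp_neg_latt_le {h : ℝ} (hh : 0 < h) :
    ∑' n : ℤ × ℤ, Real.exp (-(latt h n)) ≤ (1 + √π / h) ^ 2 := by
  have hprod := (summable_gaussR_int hh).tsum_mul_tsum (summable_gaussR_int hh)
    ((summable_gaussR_int hh).mul_of_nonneg (summable_gaussR_int hh) (fun i => gaussR_nonneg h i)
      (fun i => gaussR_nonneg h i))
  rw [tsum_congr (fun n => exp_neg_latt h n), ← hprod, ← sq]
  have h0 : 0 ≤ ∑' i : ℤ, gaussR h i := tsum_nonneg fun i => gaussR_nonneg h i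
  exact pow_le_pow_left₀ h0 (tsum_gaussR_int_le hh) 2

/-! ## §3 The primed sums over the dual torus `𝕋*_j = 2πL^{−j}ℤ²` -/

/-- the mesh `h = 2πL^{−j}` of the dual torus `𝕋*_j = 2πL^{−j}ℤ²` ("`𝕋*_M = 2πL^{−M}ℤ²`").
[cite: DimockYuan2024GrossNeveuFlow, §2.1 (arXiv TeX l. 316)] -/
def dualMesh (L : ℝ) (j : ℕ) : ℝ := 2 * π / L ^ j

/-- the summand family of a primed sum of a radial integrand `F(p²)`, with the printed exclusion `p ≠ 0`. [folklore] -/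
def term (h : ℝ) (F : ℝ → ℝ) (n : ℤ × ℤ) : ℝ := if n = 0 then 0 else F (latt h n)

/-- **the primed sum** of a radial integrand over the dual torus:
`Σ'_{p∈𝕋*_j} F(p²) := L^{−2j} Σ_{p∈𝕋*_j, p≠0} F(p²)`, `𝕋*_j = 2πL^{−j}ℤ²`
("The primed sum is a weighted sum with `p ≠ 0` defined by `Σ'_{p∈𝕋*_{N+M−k}}[⋯] = L^{−2(M+N−k)} Σ_{p∈𝕋*_{N+M−k}, p≠0}[⋯]`";
here `j = M+N−k` and the prefactor is written `((L^j)⁻¹)²`).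
[cite: DimockYuan2024GrossNeveuFlow, eq. (prime) (arXiv TeX ll. 361–364)] -/
def primedSum (L : ℝ) (j : ℕ) (F : ℝ → ℝ) : ℝ := (L ^ j)⁻¹ ^ 2 * ∑' n : ℤ × ℤ, term (dualMesh L j) F n

/-- `h = 2πL^{−j} > 0`. [folklore] -/
theorem dualMesh_pos {L : ℝ} (hL : 0 < L) (j : ℕ) : 0 < dualMesh L j := by
  unfold dualMesh; positivity

/-- `h = 2πL^{−j} ≤ 2π` for `L ≥ 1` (all tori at least unit size). [folklore] -/
theorem dualMesh_le {L : ℝ} (hL : 1 ≤ L) (j : ℕ) : dualMesh L j ≤ 2 * π := by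
  unfold dualMesh
  exact div_le_self (by positivity) (one_le_pow₀ hL)

/-- the primed weight is the Riemann-sum weight: `(L^j)⁻¹ = h/(2π)`. [folklore] -/
theorem inv_pow_eq_dualMesh_div {L : ℝ} (hL : 0 < L) (j : ℕ) : (L ^ j)⁻¹ = dualMesh L j / (2 * π) := by
  unfold dualMesh
  have hLj : L ^ j ≠ 0 := pow_ne_zero _ hL.ne'
  have hπ : (2 * π) ≠ 0 := by positivity
  field_simp

/-- the summand vanishes at `p = 0` and is `F(p²)` otherwise. [folklore] -/
theorem term_of_ne {h : ℝ} {F : ℝ → ℝ} {n : ℤ × ℤ} (hn : n ≠ 0) : term h F n = F (latt h n) := by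
  simp [term, hn]

/-- non-negativity of the summands from `F ≥ 0` on `(0,∞)`. [folklore] -/
theorem term_nonneg {h : ℝ} (hh : 0 < h) {F : ℝ → ℝ} (hF : ∀ t, 0 < t → 0 ≤ F t) (n : ℤ × ℤ) :
    0 ≤ term h F n := by
  unfold term
  split_ifs with hn
  · exact le_rfl
  · exact hF _ (latt_pos hh hn)

/-- Gaussian domination of the summands: `F(t) ≤ K e^{−t}` on `(0,∞)` with `K ≥ 0` gives
`term ≤ K e^{−p²}` at every lattice point. [folklore] -/
theorem term_le_exp {h : ℝ} (hh : 0 < h) {F : ℝ → ℝ} {K : ℝ} (hK : 0 ≤ K)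
    (hF : ∀ t, 0 < t → F t ≤ K * Real.exp (-t)) (n : ℤ × ℤ) :
    term h F n ≤ K * Real.exp (-(latt h n)) := by
  unfold term
  split_ifs with hn
  · have : 0 ≤ Real.exp (-(latt h n)) := (Real.exp_pos _).le
    positivity
  · exact hF _ (latt_pos hh hn)

/-- summability of a Gaussian-dominated non-negative summand family, for every mesh `h > 0`. [folklore] -/
theorem summable_term {h : ℝ} (hh : 0 < h) {F : ℝ → ℝ} {K : ℝ} (hK : 0 ≤ K)
    (hF0 : ∀ t, 0 < t → 0 ≤ F t) (hF : ∀ t, 0 < t → F t ≤ K * Real.exp (-t)) :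
    Summable (term h F) :=
  Summable.of_nonneg_of_le (term_nonneg hh hF0) (term_le_exp hh hK hF)
    ((summable_exp_neg_latt hh).mul_left K)

/-- pointwise comparison of two primed sums (summable families, `F ≤ G` on `(0,∞)`). [folklore] -/
theorem primedSum_mono {L : ℝ} (hL : 0 < L) (j : ℕ) {F G : ℝ → ℝ}
    (hF : Summable (term (dualMesh L j) F)) (hG : Summable (term (dualMesh L j) G))
    (hle : ∀ t, 0 < t → F t ≤ G t) : primedSum L j F ≤ primedSum L j G := by
  unfold primedSum
  refine mul_le_mul_of_nonneg_left ?_ (sq_nonneg _)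
  refine hF.tsum_le_tsum (fun n => ?_) hG
  unfold term
  split_ifs with hn
  · exact le_rfl
  · exact hle _ (latt_pos (dualMesh_pos hL j) hn)

/-- additivity of the primed sum over summable families. [folklore] -/
theorem primedSum_add {L : ℝ} (j : ℕ) {F G : ℝ → ℝ}
    (hF : Summable (term (dualMesh L j) F)) (hG : Summable (term (dualMesh L j) G)) :
    primedSum L j (fun t => F t + G t) = primedSum L j F + primedSum L j G := by
  unfold primedSum
  have hterm : ∀ n, term (dualMesh L j) (fun t => F t + G t) n = term (dualMesh L j) F n + term (dualMesh L j) G n := by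
    intro n
    unfold term
    split_ifs <;> simp
  rw [tsum_congr hterm, hF.tsum_add hG]
  ring

/-- homogeneity of the primed sum. [folklore] -/
theorem primedSum_const_mul {L : ℝ} (j : ℕ) (F : ℝ → ℝ) (c : ℝ) :
    primedSum L j (fun t => c * F t) = c * primedSum L j F := by
  unfold primedSum
  have hterm : ∀ n, term (dualMesh L j) (fun t => c * F t) n = c * term (dualMesh L j) F n := by
    intro n
    unfold term
    split_ifs <;> simp
  rw [tsum_congr hterm, tsum_mul_left]
  ring

/-- non-negativity of a primed sum of a summable non-negative family. [folklore] -/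
theorem primedSum_nonneg {L : ℝ} (hL : 0 < L) (j : ℕ) {F : ℝ → ℝ}
    (hF0 : ∀ t, 0 < t → 0 ≤ F t) : 0 ≤ primedSum L j F := by
  unfold primedSum
  exact mul_nonneg (sq_nonneg _) (tsum_nonneg (term_nonneg (dualMesh_pos hL j) hF0))

/-- **upper half of 'which suffices', uniformly in the torus**: for `L ≥ 1`, every `j ≥ 0` and every radial
integrand with `0 ≤ F(t) ≤ K e^{−t}` on `(0,∞)`,
`Σ'_{p∈𝕋*_j} F(p²) ≤ K·((h + √π)/(2π))² ≤ K·(1 + √π/(2π))²`, `h = 2πL^{−j}` — a bound free of `j`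
(§1–§2 with the primed weight `L^{−2j} = (h/2π)²`). [folklore] -/
theorem primedSum_le {L : ℝ} (hL : 1 ≤ L) (j : ℕ) {F : ℝ → ℝ} {K : ℝ} (hK : 0 ≤ K)
    (hF0 : ∀ t, 0 < t → 0 ≤ F t) (hF : ∀ t, 0 < t → F t ≤ K * Real.exp (-t)) :
    primedSum L j F ≤ K * (1 + √π / (2 * π)) ^ 2 := by
  have hL0 : 0 < L := lt_of_lt_of_le one_pos hL
  have hh := dualMesh_pos hL0 j
  set h := dualMesh L j with hdef
  have hsum := summable_term hh hK hF0 hF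
  have hexp := summable_exp_neg_latt hh
  unfold primedSum
  rw [inv_pow_eq_dualMesh_div hL0 j, ← hdef]
  have step1 : ∑' n : ℤ × ℤ, term h F n ≤ K * ∑' n : ℤ × ℤ, Real.exp (-(latt h n)) := by
    rw [← tsum_mul_left]
    exact hsum.tsum_le_tsum (term_le_exp hh hK hF) (hexp.mul_left K)
  have step2 : ∑' n : ℤ × ℤ, Real.exp (-(latt h n)) ≤ (1 + √π / h) ^ 2 := tsum_exp_neg_latt_le hh
  have hπ : 0 < 2 * π := by positivity
  have hw : 0 ≤ (h / (2 * π)) ^ 2 := sq_nonneg _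
  calc (h / (2 * π)) ^ 2 * ∑' n : ℤ × ℤ, term h F n
      ≤ (h / (2 * π)) ^ 2 * (K * (1 + √π / h) ^ 2) := by
        refine mul_le_mul_of_nonneg_left (step1.trans ?_) hw
        exact mul_le_mul_of_nonneg_left step2 hK
    _ = K * ((h + √π) / (2 * π)) ^ 2 := by
        field_simp
    _ ≤ K * (1 + √π / (2 * π)) ^ 2 := by
        refine mul_le_mul_of_nonneg_left ?_ hK
        have hle : (h + √π) / (2 * π) ≤ 1 + √π / (2 * π) := by
          rw [add_div]
          have : h / (2 * π) ≤ 1 := (div_le_one hπ).mpr (dualMesh_le hL j)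
          linarith
        have hnn : 0 ≤ (h + √π) / (2 * π) := by positivity
        exact pow_le_pow_left₀ hnn hle 2

/-- the special case `F = e^{−t}`: `Σ'_{p∈𝕋*_j} e^{−p²} ≤ (1 + √π/(2π))²` for all `L ≥ 1`, `j ≥ 0`. [folklore] -/
theorem primedSum_exp_le {L : ℝ} (hL : 1 ≤ L) (j : ℕ) :
    primedSum L j (fun t => Real.exp (-t)) ≤ (1 + √π / (2 * π)) ^ 2 := by
  have := primedSum_le hL j zero_le_one (F := fun t => Real.exp (-t)) (fun t _ => (Real.exp_pos _).le)
    (fun t _ => by simp)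
  simpa using this

/-- **lower half of 'which suffices', uniformly in the torus — one square annulus at scale `1/h`.**
For `L ≥ 1`, `j ≥ 0`, `h = 2πL^{−j}`, `m = ⌈1/h⌉`: the `(m+1)(2m+1) ≥ 2m²` points `n ∈ [m,2m]×[−m,m]` of `ℤ²` are
non-zero and have `p² = h²|n|² ∈ [(hm)², 5(hm)²] ⊆ [1, 5(1+2π)²]` (as `1 ≤ hm < 1+h ≤ 1+2π`); hence for a summable
non-negative radial integrand with `F ≥ F₀ ≥ 0` on `[1, 5(1+2π)²]`,
`Σ'_{p∈𝕋*_j} F(p²) ≥ (h/2π)²·2m²·F₀ ≥ F₀/(2π²)`.  The constant is free of `j` — INCLUDING the unit torus `j = 0`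
(`h = 2π`, `m = 1`). [folklore] -/
theorem primedSum_lower {L : ℝ} (hL : 1 ≤ L) (j : ℕ) {F : ℝ → ℝ} {F₀ : ℝ} (hF₀ : 0 ≤ F₀)
    (hF0 : ∀ t, 0 < t → 0 ≤ F t) (hsum : Summable (term (dualMesh L j) F))
    (hF : ∀ t, 1 ≤ t → t ≤ 5 * (1 + 2 * π) ^ 2 → F₀ ≤ F t) :
    F₀ / (2 * π ^ 2) ≤ primedSum L j F := by
  have hL0 : 0 < L := lt_of_lt_of_le one_pos hL
  have hh := dualMesh_pos hL0 j
  have hh2π := dualMesh_le hL j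
  set h := dualMesh L j with hdef
  -- the scale `m = ⌈1/h⌉ ≥ 1`, with `1 ≤ h m < 1 + h`
  set m : ℕ := ⌈h⁻¹⌉₊ with hmdef
  have hinv : 0 < h⁻¹ := inv_pos.mpr hh
  have hm1 : 1 ≤ m := Nat.one_le_ceil_iff.mpr hinv
  have hm_ge : h⁻¹ ≤ (m : ℝ) := Nat.le_ceil _
  have hm_lt : (m : ℝ) < h⁻¹ + 1 := Nat.ceil_lt_add_one hinv.le
  have hhm1 : 1 ≤ h * m := by
    have := mul_le_mul_of_nonneg_left hm_ge hh.le
    rwa [mul_inv_cancel₀ hh.ne'] at this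
  have hhm2 : h * m ≤ 1 + 2 * π := by
    have := mul_le_mul_of_nonneg_left hm_lt.le hh.le
    rw [mul_add, mul_inv_cancel₀ hh.ne', mul_one] at this
    linarith
  have hm0 : (0:ℝ) < m := by exact_mod_cast hm1
  -- the annulus-rectangle `R = [m,2m] × [−m,m]`
  set R : Finset (ℤ × ℤ) := Finset.Icc (m : ℤ) (2 * m) ×ˢ Finset.Icc (-(m : ℤ)) m with hRdef
  have c1 : (Finset.Icc (m : ℤ) (2 * m)).card = m + 1 := by
    rw [Int.card_Icc]; omega
  have c2 : (Finset.Icc (-(m : ℤ)) m).card = 2 * m + 1 := by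
    rw [Int.card_Icc]; omega
  have hRcard : R.card = (m + 1) * (2 * m + 1) := by
    rw [hRdef, Finset.card_product, c1, c2]
  -- every point of `R` is non-zero and has `p²` in the window
  have hwin : ∀ n ∈ R, F₀ ≤ term h F n := by
    intro n hn
    rw [hRdef, Finset.mem_product, Finset.mem_Icc, Finset.mem_Icc] at hn
    obtain ⟨⟨h1a, h1b⟩, ⟨h2a, h2b⟩⟩ := hn
    have hn0 : n ≠ 0 := by
      intro h0
      rw [h0, Prod.fst_zero] at h1a
      have : (1 : ℤ) ≤ m := by exact_mod_cast hm1
      omega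
    rw [term_of_ne hn0]
    have c1a : (m : ℝ) ≤ (n.1 : ℝ) := by exact_mod_cast h1a
    have c1b : (n.1 : ℝ) ≤ 2 * (m : ℝ) := by exact_mod_cast h1b
    have c2a : -(m : ℝ) ≤ (n.2 : ℝ) := by exact_mod_cast h2a
    have c2b : (n.2 : ℝ) ≤ (m : ℝ) := by exact_mod_cast h2b
    have hsq_lo : (m : ℝ) ^ 2 ≤ (n.1 : ℝ) ^ 2 + (n.2 : ℝ) ^ 2 := by nlinarith
    have hsq_hi : (n.1 : ℝ) ^ 2 + (n.2 : ℝ) ^ 2 ≤ 5 * (m : ℝ) ^ 2 := by nlinarith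
    apply hF
    · -- `1 ≤ (hm)² ≤ h²|n|²`
      unfold latt
      have : 1 ≤ (h * m) ^ 2 := by nlinarith
      calc (1:ℝ) ≤ (h * m) ^ 2 := this
        _ = h ^ 2 * (m : ℝ) ^ 2 := by ring
        _ ≤ h ^ 2 * ((n.1 : ℝ) ^ 2 + (n.2 : ℝ) ^ 2) := mul_le_mul_of_nonneg_left hsq_lo (sq_nonneg h)
    · -- `h²|n|² ≤ 5(hm)² ≤ 5(1+2π)²`
      unfold latt
      have h5 : (h * m) ^ 2 ≤ (1 + 2 * π) ^ 2 :=
        pow_le_pow_left₀ (by positivity) hhm2 2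
      calc h ^ 2 * ((n.1 : ℝ) ^ 2 + (n.2 : ℝ) ^ 2) ≤ h ^ 2 * (5 * (m : ℝ) ^ 2) :=
            mul_le_mul_of_nonneg_left hsq_hi (sq_nonneg h)
        _ = 5 * (h * m) ^ 2 := by ring
        _ ≤ 5 * (1 + 2 * π) ^ 2 := by linarith
  -- the finite sub-sum dominates `card R • F₀`
  have hfin : (R.card : ℝ) * F₀ ≤ ∑ n ∈ R, term h F n := by
    have := Finset.card_nsmul_le_sum R (term h F) F₀ hwin
    rwa [nsmul_eq_mul] at this
  have htsum : ∑ n ∈ R, term h F n ≤ ∑' n : ℤ × ℤ, term h F n :=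
    hsum.sum_le_tsum R (fun n _ => term_nonneg hh hF0 n)
  have hcard_lo : 2 * (m : ℝ) ^ 2 ≤ (R.card : ℝ) := by
    rw [hRcard]
    push_cast
    nlinarith
  unfold primedSum
  rw [inv_pow_eq_dualMesh_div hL0 j, ← hdef]
  have hπ : 0 < π := Real.pi_pos
  calc F₀ / (2 * π ^ 2) ≤ (h * m) ^ 2 * F₀ / (2 * π ^ 2) := by
        apply div_le_div_of_nonneg_right _ (by positivity)
        have : 1 ≤ (h * m) ^ 2 := by nlinarith
        nlinarith
    _ = (h / (2 * π)) ^ 2 * (2 * (m : ℝ) ^ 2 * F₀) := by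
        field_simp
    _ ≤ (h / (2 * π)) ^ 2 * ((R.card : ℝ) * F₀) := by
        refine mul_le_mul_of_nonneg_left ?_ (sq_nonneg _)
        exact mul_le_mul_of_nonneg_right hcard_lo hF₀
    _ ≤ (h / (2 * π)) ^ 2 * ∑' n : ℤ × ℤ, term h F n :=
        mul_le_mul_of_nonneg_left (hfin.trans htsum) (sq_nonneg _)

/-! ## §4 The printed momentum sums of Lemma 11 and their two-sided bounds, uniformly in the torus -/

/-- "`∫C_k² = Σ'_p (1/p²)(e^{−p²} − e^{−L²p²})²`": the integrand `c(t)²/t`, `t = p²`, `c` = `sliceMult`.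
[cite: DimockYuan2024GrossNeveuFlow, proof of Lemma 11 (arXiv TeX l. 2249)] -/
def csqDensity (L t : ℝ) : ℝ := sliceMult L t ^ 2 / t

/-- "`∫2w_kC_k = 2Σ'_p (1/p²)(e^{−p²/L^{2k}} − e^{−p²})(e^{−p²} − e^{−L²p²})`": the integrand `2u_k(t)c(t)/t`,
`u_k` = `accumMult`. [cite: DimockYuan2024GrossNeveuFlow, proof of Lemma 11 (arXiv TeX l. 2273)] -/
def crossDensity (L : ℝ) (k : ℕ) (t : ℝ) : ℝ := 2 * (accumMult L t k * sliceMult L t) / t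

/-- the printed momentum form of `∫C_k²` on the torus `𝕋_j`, `j = M+N−k`.
[cite: DimockYuan2024GrossNeveuFlow, proof of Lemma 11 (arXiv TeX l. 2249)] -/
def intCsq (L : ℝ) (j : ℕ) : ℝ := primedSum L j (csqDensity L)

/-- the printed momentum form of `∫2w_kC_k` on the torus `𝕋_j` (index set printed `𝕋*_{N+M}`, read `𝕋*_{M+N−k}`).
[cite: DimockYuan2024GrossNeveuFlow, proof of Lemma 11 (arXiv TeX l. 2273)] -/
def intCross (L : ℝ) (j k : ℕ) : ℝ := primedSum L j (crossDensity L k)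

/-- "`β_k = 4(n−1)∫[(w_k + C_k)² − w_k²] = 4(n−1)∫[2w_kC_k + C_k²]`" in its printed momentum form, as a function of
the number of internal components `n`, the blocking factor `L`, the torus index `j = M+N−k` and the step `k`.
[cite: DimockYuan2024GrossNeveuFlow, proof of Lemma 11 (arXiv TeX ll. 2242–2246)] -/
def betaStep (n : ℕ) (L : ℝ) (j k : ℕ) : ℝ := 4 * ((n : ℝ) - 1) * (intCross L j k + intCsq L j)

/-- the small-region sum "`Σ'_{(L²−1)p² ≤ 1} p² e^{−2p²}`".
[cite: DimockYuan2024GrossNeveuFlow, proof of Lemma 11 (arXiv TeX ll. 2257–2259)] -/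
def regionSmall (L : ℝ) (j : ℕ) : ℝ :=
  primedSum L j (fun t => if (L ^ 2 - 1) * t ≤ 1 then t * Real.exp (-t) ^ 2 else 0)

/-- the large-region sum "`Σ'_{(L²−1)p² ≥ 1} e^{−2p²}/p²`" (the boundary `(L²−1)p² = 1` is assigned to the small
region so that the two regions PARTITION the dual torus; print lets them overlap at equality).
[cite: DimockYuan2024GrossNeveuFlow, proof of Lemma 11 (arXiv TeX ll. 2265–2267)] -/
def regionLarge (L : ℝ) (j : ℕ) : ℝ :=
  primedSum L j (fun t => if (L ^ 2 - 1) * t ≤ 1 then 0 else Real.exp (-t) ^ 2 / t)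

/-- `1 − e^{−x} ≤ x` for `x ≥ 0` (from `1 + y ≤ e^y`). [folklore] -/
theorem one_sub_exp_neg_le {x : ℝ} (_hx : 0 ≤ x) : 1 - Real.exp (-x) ≤ x := by
  have := Real.add_one_le_exp (-x)
  linarith

/-- `c(t) ≤ e^{−t} ≤ 1` for `L ≥ 1`, `t ≥ 0`. [folklore] -/
theorem sliceMult_le_exp {L t : ℝ} (hL : 1 ≤ L) (ht : 0 ≤ t) : sliceMult L t ≤ Real.exp (-t) := by
  rw [sliceMult_eq]
  have hx : 0 ≤ (L ^ 2 - 1) * t := mul_nonneg (by nlinarith) ht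
  have h1 : 1 - Real.exp (-((L ^ 2 - 1) * t)) ≤ 1 := by
    have := Real.exp_pos (-((L ^ 2 - 1) * t)); linarith
  have := mul_le_mul_of_nonneg_left h1 (Real.exp_pos (-t)).le
  simpa using this

/-- `c(t) ≤ (L²−1) t e^{−t}` for `L ≥ 1`, `t ≥ 0` ("`(e^{−p²} − e^{−L²p²})` is `𝒪(p²)` as `p → 0` and `𝒪(e^{−p²})` as
`p → ∞`", l. 2277, in one inequality). [cite: DimockYuan2024GrossNeveuFlow, proof of Lemma 11 (arXiv TeX l. 2277)] -/
theorem sliceMult_le_mul_exp {L t : ℝ} (hL : 1 ≤ L) (ht : 0 ≤ t) :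
    sliceMult L t ≤ (L ^ 2 - 1) * t * Real.exp (-t) := by
  rw [sliceMult_eq]
  have hx : 0 ≤ (L ^ 2 - 1) * t := mul_nonneg (by nlinarith) ht
  have h1 := one_sub_exp_neg_le hx
  have := mul_le_mul_of_nonneg_left h1 (Real.exp_pos (-t)).le
  linarith

/-- `0 ≤ c(t)²/t` on `(0,∞)`. [folklore] -/
theorem csqDensity_nonneg (L : ℝ) {t : ℝ} (ht : 0 < t) : 0 ≤ csqDensity L t :=
  div_nonneg (sq_nonneg _) ht.le

/-- Gaussian domination `c(t)²/t ≤ (L²−1) e^{−t}` on `(0,∞)`, `L ≥ 1`. [folklore] -/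
theorem csqDensity_le {L t : ℝ} (hL : 1 ≤ L) (ht : 0 < t) :
    csqDensity L t ≤ (L ^ 2 - 1) * Real.exp (-t) := by
  unfold csqDensity
  have hc0 := sliceMult_nonneg hL ht.le
  have hc1 : sliceMult L t ≤ 1 := (sliceMult_le_exp hL ht.le).trans (by
    rw [Real.exp_le_one_iff]; linarith)
  have hcm := sliceMult_le_mul_exp hL ht.le
  rw [div_le_iff₀ ht]
  calc sliceMult L t ^ 2 = sliceMult L t * sliceMult L t := sq _
    _ ≤ 1 * sliceMult L t := mul_le_mul_of_nonneg_right hc1 hc0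
    _ ≤ (L ^ 2 - 1) * t * Real.exp (-t) := by rw [one_mul]; exact hcm
    _ = (L ^ 2 - 1) * Real.exp (-t) * t := by ring

/-- `0 ≤ 2u_k(t)c(t)/t` on `(0,∞)`, `L ≥ 1` ("Since this is positive").
[cite: DimockYuan2024GrossNeveuFlow, proof of Lemma 11 (arXiv TeX l. 2276)] -/
theorem crossDensity_nonneg {L : ℝ} (hL : 1 ≤ L) (k : ℕ) {t : ℝ} (ht : 0 < t) : 0 ≤ crossDensity L k t := by
  unfold crossDensity
  have := (crossTerm_bounds hL ht.le k).1
  have h2 : 0 ≤ 2 * (accumMult L t k * sliceMult L t) := by linarith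
  exact div_nonneg h2 ht.le

/-- Gaussian domination `2u_k(t)c(t)/t ≤ 2(L²−1) e^{−t}` on `(0,∞)`, `L ≥ 1`, EVERY `k` ("So this term is bounded by
a constant"). [cite: DimockYuan2024GrossNeveuFlow, proof of Lemma 11 (arXiv TeX ll. 2276–2278)] -/
theorem crossDensity_le {L : ℝ} (hL : 1 ≤ L) (k : ℕ) {t : ℝ} (ht : 0 < t) :
    crossDensity L k t ≤ 2 * (L ^ 2 - 1) * Real.exp (-t) := by
  unfold crossDensity
  have hup := (crossTerm_bounds hL ht.le k).2
  have hcm := sliceMult_le_mul_exp hL ht.le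
  rw [div_le_iff₀ ht]
  calc 2 * (accumMult L t k * sliceMult L t) = 2 * accumMult L t k * sliceMult L t := by ring
    _ ≤ 2 * sliceMult L t := hup
    _ ≤ 2 * ((L ^ 2 - 1) * t * Real.exp (-t)) := by linarith
    _ = 2 * (L ^ 2 - 1) * Real.exp (-t) * t := by ring

/-- summability of the `∫C_k²` family on every dual torus. [folklore] -/
theorem summable_csq {L : ℝ} (hL : 1 ≤ L) (j : ℕ) : Summable (term (dualMesh L j) (csqDensity L)) :=
  summable_term (dualMesh_pos (lt_of_lt_of_le one_pos hL) j) (by nlinarith) (fun _ ht => csqDensity_nonneg L ht)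
    (fun _ ht => csqDensity_le hL ht)

/-- summability of the `∫2w_kC_k` family on every dual torus. [folklore] -/
theorem summable_cross {L : ℝ} (hL : 1 ≤ L) (j k : ℕ) : Summable (term (dualMesh L j) (crossDensity L k)) :=
  summable_term (dualMesh_pos (lt_of_lt_of_le one_pos hL) j) (by nlinarith) (fun _ ht => crossDensity_nonneg hL k ht)
    (fun _ ht => crossDensity_le hL k ht)

/-- `0 ≤ ∫C_k²`. [folklore] -/
theorem intCsq_nonneg {L : ℝ} (hL : 1 ≤ L) (j : ℕ) : 0 ≤ intCsq L j :=
  primedSum_nonneg (lt_of_lt_of_le one_pos hL) j (fun _ ht => csqDensity_nonneg L ht)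

/-- **`∫C_k²` bounded above uniformly in the torus**: `∫C_k² ≤ (L²−1)(1 + √π/(2π))²` for all `L ≥ 1`, `j ≥ 0`.
[cite: DimockYuan2024GrossNeveuFlow, proof of Lemma 11 (arXiv TeX ll. 2252–2268, 'which suffices')] -/
theorem intCsq_le {L : ℝ} (hL : 1 ≤ L) (j : ℕ) : intCsq L j ≤ (L ^ 2 - 1) * (1 + √π / (2 * π)) ^ 2 :=
  primedSum_le hL j (by nlinarith) (fun _ ht => csqDensity_nonneg L ht) (fun _ ht => csqDensity_le hL ht)

/-- "Since this is positive": `0 ≤ ∫2w_kC_k` for all `L ≥ 1`, `j`, `k`.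
[cite: DimockYuan2024GrossNeveuFlow, proof of Lemma 11 (arXiv TeX l. 2276)] -/
theorem intCross_nonneg {L : ℝ} (hL : 1 ≤ L) (j k : ℕ) : 0 ≤ intCross L j k :=
  primedSum_nonneg (lt_of_lt_of_le one_pos hL) j (fun _ ht => crossDensity_nonneg hL k ht)

/-- "So this term is bounded by a constant": `∫2w_kC_k ≤ 2(L²−1)(1 + √π/(2π))²` for all `L ≥ 1`, `j`, `k` — the
constant is free of `j` AND `k`. [cite: DimockYuan2024GrossNeveuFlow, proof of Lemma 11 (arXiv TeX ll. 2276–2278)] -/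
theorem intCross_le {L : ℝ} (hL : 1 ≤ L) (j k : ℕ) :
    intCross L j k ≤ 2 * (L ^ 2 - 1) * (1 + √π / (2 * π)) ^ 2 :=
  primedSum_le hL j (by nlinarith) (fun _ ht => crossDensity_nonneg hL k ht) (fun _ ht => crossDensity_le hL k ht)

/-- the small-region integrand is non-negative and Gaussian-dominated: `0 ≤ 𝟙 t e^{−2t} ≤ (L²−1)⁻¹ e^{−t}` for
`L > 1` (on the region `t ≤ (L²−1)⁻¹`). [folklore] -/
theorem regionSmall_density_bounds {L t : ℝ} (hL : 1 < L) (ht : 0 < t) :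
    0 ≤ (if (L ^ 2 - 1) * t ≤ 1 then t * Real.exp (-t) ^ 2 else 0) ∧
    (if (L ^ 2 - 1) * t ≤ 1 then t * Real.exp (-t) ^ 2 else 0) ≤ (L ^ 2 - 1)⁻¹ * Real.exp (-t) := by
  have hL2 : 0 < L ^ 2 - 1 := by nlinarith
  have he : 0 < Real.exp (-t) := Real.exp_pos _
  have he1 : Real.exp (-t) ≤ 1 := by rw [Real.exp_le_one_iff]; linarith
  split_ifs with hreg
  · refine ⟨by positivity, ?_⟩
    have ht1 : t ≤ (L ^ 2 - 1)⁻¹ := by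
      rw [le_inv_comm₀ ht hL2]
      calc L ^ 2 - 1 = ((L ^ 2 - 1) * t) / t := by field_simp
        _ ≤ 1 / t := div_le_div_of_nonneg_right hreg ht.le
        _ = t⁻¹ := one_div t
    calc t * Real.exp (-t) ^ 2 = t * Real.exp (-t) * Real.exp (-t) := by ring
      _ ≤ (L ^ 2 - 1)⁻¹ * 1 * Real.exp (-t) := by
          apply mul_le_mul_of_nonneg_right _ he.le
          exact mul_le_mul ht1 he1 he.le (inv_nonneg.mpr hL2.le)
      _ = (L ^ 2 - 1)⁻¹ * Real.exp (-t) := by ring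
  · refine ⟨le_rfl, ?_⟩
    positivity

/-- the large-region integrand is non-negative and Gaussian-dominated: `0 ≤ 𝟙 e^{−2t}/t ≤ (L²−1) e^{−t}` for `L > 1`
(on the region `t > (L²−1)⁻¹`). [folklore] -/
theorem regionLarge_density_bounds {L t : ℝ} (hL : 1 < L) (ht : 0 < t) :
    0 ≤ (if (L ^ 2 - 1) * t ≤ 1 then 0 else Real.exp (-t) ^ 2 / t) ∧
    (if (L ^ 2 - 1) * t ≤ 1 then 0 else Real.exp (-t) ^ 2 / t) ≤ (L ^ 2 - 1) * Real.exp (-t) := by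
  have hL2 : 0 < L ^ 2 - 1 := by nlinarith
  have he : 0 < Real.exp (-t) := Real.exp_pos _
  have he1 : Real.exp (-t) ≤ 1 := by rw [Real.exp_le_one_iff]; linarith
  split_ifs with hreg
  · refine ⟨le_rfl, ?_⟩
    positivity
  · refine ⟨by positivity, ?_⟩
    push Not at hreg
    rw [div_le_iff₀ ht]
    have hinv : t⁻¹ ≤ L ^ 2 - 1 := by
      rw [inv_le_comm₀ ht hL2]
      have : (L ^ 2 - 1)⁻¹ * ((L ^ 2 - 1) * t) = t := by field_simp
      rw [← this]
      have := mul_le_mul_of_nonneg_left hreg.le (inv_nonneg.mpr hL2.le)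
      simpa using this
    calc Real.exp (-t) ^ 2 = Real.exp (-t) * Real.exp (-t) * (t⁻¹ * t) := by
          rw [inv_mul_cancel₀ ht.ne']; ring
      _ ≤ 1 * Real.exp (-t) * ((L ^ 2 - 1) * t) := by
          apply mul_le_mul _ (mul_le_mul_of_nonneg_right hinv ht.le) (by positivity) (by positivity)
          exact mul_le_mul_of_nonneg_right he1 he.le
      _ = (L ^ 2 - 1) * Real.exp (-t) * t := by ring

/-- summability of the small-region family. [folklore] -/
theorem summable_regionSmall {L : ℝ} (hL : 1 < L) (j : ℕ) :
    Summable (term (dualMesh L j) (fun t => if (L ^ 2 - 1) * t ≤ 1 then t * Real.exp (-t) ^ 2 else 0)) :=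
  summable_term (dualMesh_pos (lt_trans one_pos hL) j) (inv_nonneg.mpr (by nlinarith))
    (fun _ ht => (regionSmall_density_bounds hL ht).1) (fun _ ht => (regionSmall_density_bounds hL ht).2)

/-- summability of the large-region family. [folklore] -/
theorem summable_regionLarge {L : ℝ} (hL : 1 < L) (j : ℕ) :
    Summable (term (dualMesh L j) (fun t => if (L ^ 2 - 1) * t ≤ 1 then 0 else Real.exp (-t) ^ 2 / t)) :=
  summable_term (dualMesh_pos (lt_trans one_pos hL) j) (by nlinarith)
    (fun _ ht => (regionLarge_density_bounds hL ht).1) (fun _ ht => (regionLarge_density_bounds hL ht).2)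

/-- **'which suffices' (small region), uniformly in the torus**: `0 ≤ Σ'_{(L²−1)p²≤1} p²e^{−2p²} ≤ (L²−1)⁻¹(1 + √π/(2π))²`
for all `L > 1`, `j ≥ 0`. [cite: DimockYuan2024GrossNeveuFlow, proof of Lemma 11 (arXiv TeX l. 2260)] -/
theorem regionSmall_le {L : ℝ} (hL : 1 < L) (j : ℕ) :
    0 ≤ regionSmall L j ∧ regionSmall L j ≤ (L ^ 2 - 1)⁻¹ * (1 + √π / (2 * π)) ^ 2 :=
  ⟨primedSum_nonneg (lt_trans one_pos hL) j (fun _ ht => (regionSmall_density_bounds hL ht).1),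
   primedSum_le hL.le j (inv_nonneg.mpr (by nlinarith)) (fun _ ht => (regionSmall_density_bounds hL ht).1)
    (fun _ ht => (regionSmall_density_bounds hL ht).2)⟩

/-- **'which also suffices' (large region), upper half, uniformly in the torus**:
`0 ≤ Σ'_{(L²−1)p²>1} e^{−2p²}/p² ≤ (L²−1)(1 + √π/(2π))²` for all `L > 1`, `j ≥ 0`.
[cite: DimockYuan2024GrossNeveuFlow, proof of Lemma 11 (arXiv TeX l. 2268)] -/
theorem regionLarge_le {L : ℝ} (hL : 1 < L) (j : ℕ) :
    0 ≤ regionLarge L j ∧ regionLarge L j ≤ (L ^ 2 - 1) * (1 + √π / (2 * π)) ^ 2 :=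
  ⟨primedSum_nonneg (lt_trans one_pos hL) j (fun _ ht => (regionLarge_density_bounds hL ht).1),
   primedSum_le hL.le j (by nlinarith) (fun _ ht => (regionLarge_density_bounds hL ht).1)
    (fun _ ht => (regionLarge_density_bounds hL ht).2)⟩

/-- the window constant `T = 5(1+2π)²` of the square annulus (§3). [folklore] -/
def Tmax : ℝ := 5 * (1 + 2 * π) ^ 2

/-- `T ≥ 1`. [folklore] -/
theorem one_le_Tmax : 1 ≤ Tmax := by
  unfold Tmax
  have := Real.pi_pos
  nlinarith

/-- **'which also suffices' (large region), LOWER half, uniformly in the torus**: for `L ≥ 2` (so that the window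
`p² ∈ [1, T]` of the square annulus lies inside the large region `(L²−1)p² > 1`),
`Σ'_{(L²−1)p²>1} e^{−2p²}/p² ≥ (e^{−2T}/T)/(2π²)` for every `j ≥ 0`, INCLUDING the unit torus.
[cite: DimockYuan2024GrossNeveuFlow, proof of Lemma 11 (arXiv TeX l. 2268)] -/
theorem regionLarge_lower {L : ℝ} (hL : 2 ≤ L) (j : ℕ) :
    (Real.exp (-Tmax) ^ 2 / Tmax) / (2 * π ^ 2) ≤ regionLarge L j := by
  have hL1 : 1 < L := by linarith
  have hT := one_le_Tmax
  refine primedSum_lower hL1.le j (by positivity) (fun _ ht => (regionLarge_density_bounds hL1 ht).1)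
    (summable_regionLarge hL1 j) ?_
  intro t ht1 htT
  have hreg : ¬ ((L ^ 2 - 1) * t ≤ 1) := by
    have hL3 : 3 ≤ L ^ 2 - 1 := by nlinarith
    have h31 : (3 : ℝ) * 1 ≤ (L ^ 2 - 1) * t := mul_le_mul hL3 ht1 zero_le_one (by linarith)
    push Not
    linarith
  rw [if_neg hreg]
  have ht0 : 0 < t := by linarith
  have hTpos : 0 < Tmax := by linarith
  have htT' : t ≤ Tmax := by unfold Tmax; exact htT
  -- `e^{−t} ≥ e^{−T}` and `1/t ≥ 1/T` on the window
  have he : Real.exp (-Tmax) ≤ Real.exp (-t) := Real.exp_le_exp.mpr (by linarith)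
  have he0 : 0 ≤ Real.exp (-Tmax) := (Real.exp_pos _).le
  have hsq : Real.exp (-Tmax) ^ 2 ≤ Real.exp (-t) ^ 2 := pow_le_pow_left₀ he0 he 2
  calc Real.exp (-Tmax) ^ 2 / Tmax ≤ Real.exp (-t) ^ 2 / Tmax := div_le_div_of_nonneg_right hsq hTpos.le
    _ ≤ Real.exp (-t) ^ 2 / t := div_le_div_of_nonneg_left (sq_nonneg _) ht0 htT'

/-- **the printed two-region display, both regions together** (mode-wise `OneLoopCoefficient.sliceMult_sq_bounds_small`
/ `…_large`, summed over the dual torus with the weight `1/p²`): for `L > 1` and every `j ≥ 0`,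
`e^{−2}(L²−1)² Σ'_{small} p²e^{−2p²} + (1−e^{−1})² Σ'_{large} e^{−2p²}/p² ≤ ∫C_k² ≤ (L²−1)² Σ'_{small} p²e^{−2p²} + Σ'_{large} e^{−2p²}/p²`.
As printed the small-region lower constant reads `e^{−1}` (l. 2258); squaring the quoted `xe^{−1} ≤ 1−e^{−x}` gives
`e^{−2}` (module docstring; immaterial).
[cite: DimockYuan2024GrossNeveuFlow, proof of Lemma 11 (arXiv TeX ll. 2252–2268)] -/
theorem intCsq_regions {L : ℝ} (hL : 1 < L) (j : ℕ) :
    Real.exp (-1) ^ 2 * (L ^ 2 - 1) ^ 2 * regionSmall L j + (1 - Real.exp (-1)) ^ 2 * regionLarge L j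
      ≤ intCsq L j ∧
    intCsq L j ≤ (L ^ 2 - 1) ^ 2 * regionSmall L j + regionLarge L j := by
  have hL0 : 0 < L := lt_trans one_pos hL
  have hS := summable_regionSmall hL j
  have hLg := summable_regionLarge hL j
  have hC := summable_csq hL.le j
  unfold intCsq regionSmall regionLarge
  constructor
  · rw [← primedSum_const_mul, ← primedSum_const_mul, ← primedSum_add]
    · refine primedSum_mono hL0 j ?_ hC ?_
      · -- summability of the combined minorant family
        have h1 := (hS.mul_left (Real.exp (-1) ^ 2 * (L ^ 2 - 1) ^ 2))
        have h2 := (hLg.mul_left ((1 - Real.exp (-1)) ^ 2))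
        refine (h1.add h2).congr fun n => ?_
        unfold term
        split_ifs <;> simp
      · intro t ht
        unfold csqDensity
        split_ifs with hreg
        · -- small region: `e^{−2}(L²−1)² t e^{−2t} ≤ c(t)²/t`
          have hlo := (sliceMult_sq_bounds_small hL.le ht.le hreg).1
          rw [mul_zero, add_zero, le_div_iff₀ ht]
          calc Real.exp (-1) ^ 2 * (L ^ 2 - 1) ^ 2 * (t * Real.exp (-t) ^ 2) * t
              = Real.exp (-1) ^ 2 * ((L ^ 2 - 1) * t) ^ 2 * Real.exp (-t) ^ 2 := by ring
            _ ≤ sliceMult L t ^ 2 := hlo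
        · -- large region: `(1−e^{−1})² e^{−2t}/t ≤ c(t)²/t`
          push Not at hreg
          have hlo := (sliceMult_sq_bounds_large ht.le hreg.le).1
          rw [mul_zero, zero_add, ← mul_div_assoc]
          exact div_le_div_of_nonneg_right hlo ht.le
    · exact (hS.mul_left (Real.exp (-1) ^ 2 * (L ^ 2 - 1) ^ 2)).congr fun n => by
        unfold term; split_ifs <;> simp
    · exact (hLg.mul_left ((1 - Real.exp (-1)) ^ 2)).congr fun n => by
        unfold term; split_ifs <;> simp
  · rw [← primedSum_const_mul, ← primedSum_add]
    · refine primedSum_mono hL0 j hC ?_ ?_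
      · have h1 := (hS.mul_left ((L ^ 2 - 1) ^ 2))
        refine (h1.add hLg).congr fun n => ?_
        unfold term
        split_ifs <;> simp
      · intro t ht
        unfold csqDensity
        split_ifs with hreg
        · have hhi := (sliceMult_sq_bounds_small hL.le ht.le hreg).2
          rw [add_zero, div_le_iff₀ ht]
          calc sliceMult L t ^ 2 ≤ ((L ^ 2 - 1) * t) ^ 2 * Real.exp (-t) ^ 2 := hhi
            _ = (L ^ 2 - 1) ^ 2 * (t * Real.exp (-t) ^ 2) * t := by ring
        · push Not at hreg
          have hhi := (sliceMult_sq_bounds_large ht.le hreg.le).2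
          rw [mul_zero, zero_add]
          exact div_le_div_of_nonneg_right hhi ht.le
    · exact (hS.mul_left ((L ^ 2 - 1) ^ 2)).congr fun n => by
        unfold term; split_ifs <;> simp
    · exact hLg

/-- **`∫C_k²` bounded BELOW uniformly in the torus**: for `L ≥ 2` and every `j ≥ 0` (incl. the unit torus),
`∫C_k² ≥ (1−e^{−1})²·(e^{−2T}/T)/(2π²)` — "we already have a lower bound from the first term", obtained here, as in
print, from the LARGE region alone. [cite: DimockYuan2024GrossNeveuFlow, proof of Lemma 11 (arXiv TeX ll. 2261–2268, 2276)] -/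
theorem intCsq_lower {L : ℝ} (hL : 2 ≤ L) (j : ℕ) :
    (1 - Real.exp (-1)) ^ 2 * ((Real.exp (-Tmax) ^ 2 / Tmax) / (2 * π ^ 2)) ≤ intCsq L j := by
  have hL1 : 1 < L := by linarith
  have hreg := (intCsq_regions hL1 j).1
  have hlow := regionLarge_lower hL j
  have hS0 := (regionSmall_le hL1 j).1
  have hc : 0 ≤ (1 - Real.exp (-1)) ^ 2 := sq_nonneg _
  have h1 : 0 ≤ Real.exp (-1) ^ 2 * (L ^ 2 - 1) ^ 2 * regionSmall L j := by positivity
  have h2 := mul_le_mul_of_nonneg_left hlow hc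
  linarith

/-! ## §5 Lemma 11 (1) for the printed momentum-sum expression, with explicit constants -/

/-- the lower constant `C₋ := 2(1−e^{−1})² e^{−2T}/(π²T)`, `T = 5(1+2π)²` — free of `L`, `j`, `k`. [folklore] -/
def Cminus : ℝ := 2 * (1 - Real.exp (-1)) ^ 2 * (Real.exp (-Tmax) ^ 2 / Tmax) / π ^ 2

/-- the upper constant `C₊(L) := 16(L²−1)(1 + √π/(2π))²` — "may depend on `L`", free of `j`, `k`. [folklore] -/
def Cplus (L : ℝ) : ℝ := 16 * (L ^ 2 - 1) * (1 + √π / (2 * π)) ^ 2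

/-- `C₋ > 0`. [folklore] -/
theorem Cminus_pos : 0 < Cminus := by
  unfold Cminus
  have hT : 0 < Tmax := lt_of_lt_of_le one_pos one_le_Tmax
  have h1 : 0 < 1 - Real.exp (-1) := by
    have : Real.exp (-1) < 1 := by
      rw [Real.exp_lt_one_iff]; norm_num
    linarith
  positivity

/-- `C₊(L) > 0` for `L > 1`. [folklore] -/
theorem Cplus_pos {L : ℝ} (hL : 1 < L) : 0 < Cplus L := by
  unfold Cplus
  have : 0 < L ^ 2 - 1 := by nlinarith
  positivity

/-- **Dimock–Yuan 2024, Lemma 11 (1), for the printed momentum-sum expression of `β_k`, with explicit constants.**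
"There exist positive constants `C_±` such that `(n−1)C₋ ≤ β_k ≤ (n−1)C₊`" — here: for every real blocking factor
`L ≥ 2`, every torus `𝕋_j` (`j = M+N−k ≥ 0`, INCLUDING the unit torus), every step `k` and every number of components
`n ≥ 1`, with `C₋ = Cminus` (free of `L`, `j`, `k`) and `C₊ = Cplus L` (free of `j`, `k`; "may depend on `L`", l. 2225),
where `β_k = betaStep n L j k = 4(n−1)·[Σ' 2u_kc/p² + Σ' c²/p²]` is the printed momentum form (ll. 2244, 2249, 2273).
The model step "`∫C_k²`, `∫2w_kC_k` = these sums" (Plancherel on `ℝ²/L^jℤ²`, eq. (kingly)) is NOT reproduced.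
[cite: DimockYuan2024GrossNeveuFlow, Lemma 11 (1) (arXiv TeX ll. 2229–2278)] -/
theorem DimockYuan2024_lemma11_part1 {L : ℝ} (hL : 2 ≤ L) (j k : ℕ) {n : ℕ} (hn : 1 ≤ n) :
    ((n : ℝ) - 1) * Cminus ≤ betaStep n L j k ∧ betaStep n L j k ≤ ((n : ℝ) - 1) * Cplus L := by
  have hL1 : 1 ≤ L := by linarith
  have hn0 : 0 ≤ (n : ℝ) - 1 := by
    have : (1 : ℝ) ≤ n := by exact_mod_cast hn
    linarith
  have hcross0 := intCross_nonneg hL1 j k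
  have hcross1 := intCross_le hL1 j k
  have hcsq0 := intCsq_lower hL j
  have hcsq1 := intCsq_le hL1 j
  unfold betaStep
  constructor
  · -- lower: `4(n−1)·[0 + (1−e^{−1})²(e^{−2T}/T)/(2π²)] = (n−1)·C₋`
    have key : ((n : ℝ) - 1) * Cminus
        = 4 * ((n : ℝ) - 1) * ((1 - Real.exp (-1)) ^ 2 * ((Real.exp (-Tmax) ^ 2 / Tmax) / (2 * π ^ 2))) := by
      unfold Cminus
      have hπ : π ≠ 0 := Real.pi_pos.ne'
      field_simp
      ring
    rw [key]
    have h4 : 0 ≤ 4 * ((n : ℝ) - 1) := by positivity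
    exact mul_le_mul_of_nonneg_left (by linarith) h4
  · -- upper: `4(n−1)·[2(L²−1) + (L²−1)](1+√π/(2π))² ≤ (n−1)·16(L²−1)(1+√π/(2π))²`
    have hL2 : 0 ≤ L ^ 2 - 1 := by nlinarith
    have hP : 0 ≤ (1 + √π / (2 * π)) ^ 2 := sq_nonneg _
    have key : ((n : ℝ) - 1) * Cplus L = 4 * ((n : ℝ) - 1) * (4 * (L ^ 2 - 1) * (1 + √π / (2 * π)) ^ 2) := by
      unfold Cplus; ring
    rw [key]
    have h4 : 0 ≤ 4 * ((n : ℝ) - 1) := by positivity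
    refine mul_le_mul_of_nonneg_left ?_ h4
    have : 0 ≤ (L ^ 2 - 1) * (1 + √π / (2 * π)) ^ 2 := mul_nonneg hL2 hP
    linarith

/-- Corollary in the printed wording: positive constants, independent of `j = M+N−k` and of `k`, exist.
[cite: DimockYuan2024GrossNeveuFlow, Lemma 11 (1) (arXiv TeX ll. 2229–2237)] -/
theorem DimockYuan2024_lemma11_part1_exists {L : ℝ} (hL : 2 ≤ L) :
    ∃ Cm Cp : ℝ, 0 < Cm ∧ 0 < Cp ∧ ∀ (j k n : ℕ), 1 ≤ n →
      ((n : ℝ) - 1) * Cm ≤ betaStep n L j k ∧ betaStep n L j k ≤ ((n : ℝ) - 1) * Cp :=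
  ⟨Cminus, Cplus L, Cminus_pos, Cplus_pos (by linarith),
    fun j k _ hn => DimockYuan2024_lemma11_part1 hL j k hn⟩

end DualTorus

end Literature.MathematicalPhysics.QuantumFieldTheory.DimockYuan2024
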